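import Summits.CriticalPhenomena.Ising3DConformalLimit.Theorems.HyperoctahedralRPLimitRotationInvariantQuarterTurnDefs
import Literature.MathematicalPhysics.QuantumFieldTheory.PointwiseOSBoostContinuation
import HarnessLib

/-!
# Stub `stub_boostEntireOfType` (S4) of the line `quarter-turn-liouville`,
crux `HyperoctahedralRP.LimitRotationInvariant` (stmt-CriticalPhenomena-1980)

The inductive step: for a limit structure `S` with the in-plane light cone and the two-sided sigma
bound, rotation invariance at all levels `< n` and an axis-generic configuration `x` of `n ≥ 3`
points, the orbit function `θ ↦ S_n(rot θ ∘ x)` is the restriction of an ENTIRE function of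
exponential type `2Δ ≤ 2 < 4`.

Proof (Osterwalder–Schrader technology, Glimm–Jaffe *Quantum Physics* §19.5–19.7 run towards
rotations): only the coordinate frame `e₀` is needed — by the `pdot` clause of `AxisGeneric`, at every
real angle `θ` the `e₀`-heights of `rot θ ∘ x` are pairwise distinct OR those of `rot (θ + π/2) ∘ x`
are (`heights_injective_or`), and the orbit function is `π/2`-periodic (`orbit_periodic`). The frame-`e₀`
hypotheses (`MirrorRP e₀`, `InPlaneLightCone` at `(e₀, e₁)`, `TwoSidedSigmaBound` at `e₀`,
`PairDominated`, translation/permutation/hyperoctahedral invariance) feed the tree's pointwise OS boost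
calculus: the OS kernel is realised in Mathlib's reproducing-kernel Hilbert space
(`KernelVectors.inner_kerFun_one`), `exists_local_boost_continuation`
(`Literature/MathematicalPhysics/QuantumFieldTheory/PointwiseOSBoostContinuation`) continues the orbit
function to a vertical strip around every angle with the bound `K e^{2Δ|Im ζ|}` after sorting the
points by height (`exists_sorted_gaps`), and `exists_entire_of_periodic_local_continuations`
(`Literature/Analysis/Complex/PeriodicLocalContinuation`) glues one period.
-/

noncomputable section

open scoped BigOperators InnerProductSpace
open ComplexConjugate
open Literature.Probability.LatticeModels
open Literature.MathematicalPhysics.QuantumFieldTheory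
open Literature.Analysis.OperatorTheory Literature.Analysis.OperatorTheory.KernelVectors
  Literature.Analysis.Complex

namespace Summit.CriticalPhenomena.Ising3DConformalLimit.Cruxes.LimitRotationInvariant.QuarterTurnLiouville

local notation "E³" => EuclideanSpace ℝ (Fin 3)
local notation "e₀" => EuclideanSpace.single (0 : Fin 3) (1 : ℝ)
local notation "e₁" => EuclideanSpace.single (1 : Fin 3) (1 : ℝ)

/-! ## The frame `e₀` -/

/-- The mirror `e₀^⊥`: `refl e₀` is the coordinate reflection `θ₀`. -/
theorem refl_single_zero (x : E³) : refl e₀ x = axisReflection 0 x := by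
  ext l
  rw [axisReflection_apply]
  exact reflection_single_apply 0 x l

/-- `⟪x, e₀⟫ = x₀`. -/
theorem inner_single_zero_right (x : E³) : inner ℝ x e₀ = x 0 := by
  rw [real_inner_comm, inner_single_one_left]

/-- `e₀` is a lattice mirror normal. -/
theorem single_zero_mem : e₀ ∈ latticeMirrorNormals (Fin 3) :=
  single_mem_latticeMirrorNormals (i := 0) (j := 1) (by decide)

/-- `e₁` is a lattice mirror normal. -/
theorem single_one_mem : e₁ ∈ latticeMirrorNormals (Fin 3) :=
  single_mem_latticeMirrorNormals (i := 1) (j := 0) (by decide)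

/-- The frame-`e₀` light cone from `InPlaneLightCone` at the `B₂` pair `(e₀, e₁)`. -/
theorem frameLightCone_of {S : CorrFamily 3} (hcone : InPlaneLightCone S) :
    ∀ (m : ℕ) (k : Fin m → ℕ) (A : (a : Fin m) → Fin (k a) → E³) (c : Fin m → ℝ)
      (m' : ℕ) (k' : Fin m' → ℕ) (B : (b : Fin m') → Fin (k' b) → E³) (d : Fin m' → ℝ),
      (∀ a i, 0 < A a i 0) → (∀ b j, 0 < B b j 0) →
      ∃ G : ℂ × ℂ → ℂ, DifferentiableOn ℂ G {p : ℂ × ℂ | |p.2.im| < p.1.re} ∧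
        (∀ t y : ℝ, 0 < t → G ((t : ℂ), (y : ℂ)) =
          ((∑ a, ∑ b, c a * d b * S (k a + k' b)
            (Fin.append (fun i => axisReflection 0 (A a i)) (fun j => B b j + t • e₀ + y • e₁)) : ℝ) : ℂ)) ∧
        (∀ p : ℂ × ℂ, |p.2.im| < p.1.re → ‖G p‖ ^ 2 ≤
          (∑ a, ∑ a', c a * c a' * S (k a + k a') (Fin.append (fun i => axisReflection 0 (A a i)) (A a'))) *
          (∑ b, ∑ b', d b * d b' * S (k' b + k' b') (Fin.append (fun j => axisReflection 0 (B b j)) (B b')))) := by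
  intro m k A c m' k' B d hA hB
  obtain ⟨G, hG, hGv, hGb⟩ := hcone e₀ single_zero_mem e₁ single_one_mem
    (by rw [inner_single_one_left]; simp) (by simp) m k A c m' k' B d
    (fun a i => by rw [inner_single_zero_right]; exact hA a i)
    (fun b j => by rw [inner_single_zero_right]; exact hB b j)
  refine ⟨G, hG, fun t y ht => ?_, fun p hp => ?_⟩
  · rw [hGv t y ht]; simp only [refl_single_zero]
  · have := hGb p hp; simpa only [refl_single_zero] using this

/-- The frame-`e₀` two-sided sigma bound from `TwoSidedSigmaBound`. -/
theorem frameSigma_of {Δ : ℝ} {S : CorrFamily 3} (hsig : TwoSidedSigmaBound Δ S) :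
    ∃ C : ℝ, ∀ u v : ℝ, 0 < u → 0 < v → ∀ y : E³, y 0 = 0 →
      ∀ (m : ℕ) (k : Fin m → ℕ) (A : (a : Fin m) → Fin (k a) → E³) (c : Fin m → ℝ)
        (m' : ℕ) (k' : Fin m' → ℕ) (B : (b : Fin m') → Fin (k' b) → E³) (d : Fin m' → ℝ),
        (∀ a i, 0 < A a i 0) → (∀ b j, 0 < B b j 0) →
        (∑ a, ∑ b, c a * d b * S (k a + 1 + k' b)
            (Fin.append (Fin.append (fun i => axisReflection 0 (A a i + u • e₀)) ![y])
              (fun j => B b j + v • e₀))) ^ 2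
          ≤ (C * (u ^ (-Δ) + v ^ (-Δ))) ^ 2 *
            (∑ a, ∑ a', c a * c a' * S (k a + k a') (Fin.append (fun i => axisReflection 0 (A a i)) (A a'))) *
            (∑ b, ∑ b', d b * d b' * S (k' b + k' b') (Fin.append (fun j => axisReflection 0 (B b j)) (B b'))) := by
  obtain ⟨C, hC⟩ := hsig e₀ single_zero_mem
  refine ⟨C, fun u v hu hv y hy m k A c m' k' B d hA hB => ?_⟩
  have := hC u v hu hv y (by rw [inner_single_zero_right]; exact hy) m k A c m' k' B d
    (fun a i => by rw [inner_single_zero_right]; exact hA a i)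
    (fun b j => by rw [inner_single_zero_right]; exact hB b j)
  simpa only [refl_single_zero] using this

/-- Hyperoctahedral invariance contains the coordinate reflection `θ₀`. -/
theorem isReflectionInvariantAlong_zero {S : CorrFamily 3} (hO : IsHyperoctahedralInvariant S) :
    IsReflectionInvariantAlong 0 S := by
  intro n x
  have h := hO n 1 ![false, true, true] x
  have e : (fun i => signedPerm 1 ![false, true, true] (x i)) = fun i => axisReflection 0 (x i) := by
    funext i; ext j
    fin_cases j <;> simp [signedPerm]
  rw [e] at h
  exact h

/-- Reflection positivity in `e₀^⊥` makes the OS kernel positive semidefinite (real coefficients). -/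
theorem kernel_psd_real {S : CorrFamily 3} (hRP : MirrorRP e₀ S) (kk : ℕ)
    (xs : Fin kk → HalfSpaceConfig 3 0) (r : Fin kk → ℝ) :
    0 ≤ ∑ i, ∑ j, r i * r j * osPointKernel S (xs i) (xs j) := by
  have := hRP kk (fun i => (xs i).n) (fun i => (xs i).pts) r
    (fun a i => by rw [inner_single_zero_right]; exact (xs a).pos i)
  simp only [refl_single_zero] at this
  exact this

/-- … and positive semidefinite over complex coefficients. -/
theorem kernel_psd_complex {S : CorrFamily 3} (hRP : MirrorRP e₀ S) (c : HalfSpaceConfig 3 0 →₀ ℂ) :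
    0 ≤ (∑ x ∈ c.support, ∑ y ∈ c.support,
      conj (c x) * c y * ((osPointKernel S x y : ℝ) : ℂ)).re := by
  classical
  rw [sum_finset_eq_sum_fin c.support]
  simp only [sum_finset_eq_sum_fin c.support]
  have key : ∀ a b : HalfSpaceConfig 3 0, (conj (c a) * c b * ((osPointKernel S a b : ℝ) : ℂ)).re =
      (c a).re * (c b).re * osPointKernel S a b + (c a).im * (c b).im * osPointKernel S a b := by
    intro a b
    simp [Complex.mul_re, Complex.mul_im]
    ring
  rw [Complex.re_sum]
  simp only [Complex.re_sum, key, Finset.sum_add_distrib]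
  exact add_nonneg
    (kernel_psd_real hRP _ (fun i => (c.support.equivFin.symm i : HalfSpaceConfig 3 0))
      fun i => (c (c.support.equivFin.symm i)).re)
    (kernel_psd_real hRP _ (fun i => (c.support.equivFin.symm i : HalfSpaceConfig 3 0))
      fun i => (c (c.support.equivFin.symm i)).im)

/-! ## Axis-generic configurations: the frame `e₀` is usable at `θ` or at `θ + π/2` -/

/-- **Usable frames.** For an axis-generic `x` and any angle `θ`, the `e₀`-heights of `rot θ ∘ x` are
pairwise distinct, or those of `rot (θ + π/2) ∘ x` are: two failures give pair differences
perpendicular in the plane (`pdot = 0`), or the same pair with vanishing planar part. -/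
theorem heights_injective_or {n : ℕ} {x : Fin n → E³} (hx : AxisGeneric x) (θ : ℝ) :
    (∀ i j : Fin n, i ≠ j → rot θ (x i) 0 ≠ rot θ (x j) 0) ∨
      (∀ i j : Fin n, i ≠ j → rot (θ + Real.pi / 2) (x i) 0 ≠ rot (θ + Real.pi / 2) (x j) 0) := by
  by_contra h
  rw [not_or] at h
  obtain ⟨h1, h2⟩ := h
  push Not at h1 h2
  obtain ⟨i, j, hij, hv⟩ := h1
  obtain ⟨k, l, hkl, hw⟩ := h2
  have ev : Real.cos θ * (x i 0 - x j 0) + Real.sin θ * (x i 1 - x j 1) = 0 := by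
    simp [planeRot_apply] at hv; linarith
  have ew : -Real.sin θ * (x k 0 - x l 0) + Real.cos θ * (x k 1 - x l 1) = 0 := by
    simp [planeRot_apply, Real.cos_add_pi_div_two, Real.sin_add_pi_div_two] at hw; linarith
  have hcs := Real.cos_sq_add_sin_sq θ
  by_cases hpair : (i = k ∧ j = l) ∨ (i = l ∧ j = k)
  · have e0 : x i 0 = x j 0 ∧ x i 1 = x j 1 := by
      rcases hpair with ⟨rfl, rfl⟩ | ⟨rfl, rfl⟩
      · constructor
        · linear_combination Real.cos θ * ev - Real.sin θ * ew - (x i 0 - x j 0) * hcs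
        · linear_combination Real.sin θ * ev + Real.cos θ * ew - (x i 1 - x j 1) * hcs
      · constructor
        · linear_combination Real.cos θ * ev + Real.sin θ * ew - (x i 0 - x j 0) * hcs
        · linear_combination Real.sin θ * ev - Real.cos θ * ew - (x i 1 - x j 1) * hcs
    rcases hx.1 i j hij with h0 | h0
    · exact h0 e0.1
    · exact h0 e0.2
  · have hp := (hx.2 i j k l hij hkl hpair).1
    apply hp
    simp only [pdot, PiLp.sub_apply]
    linear_combination (Real.cos θ * (x k 0 - x l 0) + Real.sin θ * (x k 1 - x l 1)) * ev +
      (Real.cos θ * (x i 1 - x j 1) - Real.sin θ * (x i 0 - x j 0)) * ew -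
      ((x i 0 - x j 0) * (x k 0 - x l 0) + (x i 1 - x j 1) * (x k 1 - x l 1)) * hcs

/-! ## Sorting by height and uniform gaps -/

/-- Heights are `2‖y‖`-Lipschitz in the angle. -/
theorem abs_height_sub_le (y : E³) (θ θ₁ : ℝ) :
    |rot θ y 0 - rot θ₁ y 0| ≤ 2 * ‖y‖ * |θ - θ₁| := by
  have h0 : |y 0| ≤ ‖y‖ := abs_apply_le_norm_fin3 y 0
  have h1 : |y 1| ≤ ‖y‖ := abs_apply_le_norm_fin3 y 1
  have hc := Real.abs_cos_sub_cos_le θ θ₁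
  have hs := Real.abs_sin_sub_sin_le θ θ₁
  have e : rot θ y 0 - rot θ₁ y 0 = (Real.cos θ - Real.cos θ₁) * y 0 + (Real.sin θ - Real.sin θ₁) * y 1 := by
    simp [planeRot_apply]; ring
  rw [e]
  calc |(Real.cos θ - Real.cos θ₁) * y 0 + (Real.sin θ - Real.sin θ₁) * y 1|
      ≤ |(Real.cos θ - Real.cos θ₁) * y 0| + |(Real.sin θ - Real.sin θ₁) * y 1| := abs_add_le _ _
    _ = |Real.cos θ - Real.cos θ₁| * |y 0| + |Real.sin θ - Real.sin θ₁| * |y 1| := by rw [abs_mul, abs_mul]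
    _ ≤ |θ - θ₁| * ‖y‖ + |θ - θ₁| * ‖y‖ := by gcongr
    _ = 2 * ‖y‖ * |θ - θ₁| := by ring

/-- **Sorting and uniform gaps.** If the `e₀`-heights of `rot θ₁ ∘ x` are pairwise distinct, then
after a permutation they increase with uniform gaps `≥ h > 0` for all angles `|θ - θ₁| < ε ≤ 1`. -/
theorem exists_sorted_gaps {n : ℕ} (hn : 2 ≤ n) (x : Fin n → E³) (θ₁ : ℝ)
    (hdist : ∀ i j : Fin n, i ≠ j → rot θ₁ (x i) 0 ≠ rot θ₁ (x j) 0) :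
    ∃ (σ : Equiv.Perm (Fin n)) (ε h : ℝ), 0 < ε ∧ ε ≤ 1 ∧ 0 < h ∧
      ∀ i j : Fin n, i < j → ∀ θ : ℝ, |θ - θ₁| < ε → h ≤ rot θ (x (σ j)) 0 - rot θ (x (σ i)) 0 := by
  classical
  set f : Fin n → ℝ := fun i => rot θ₁ (x i) 0 with hf
  have hinj : Function.Injective f := fun i j h => by
    by_contra hne; exact hdist i j hne h
  set σ : Equiv.Perm (Fin n) := Tuple.sort f with hσ
  have hmono : StrictMono (f ∘ σ) := (Tuple.monotone_sort f).strictMono_of_injective (hinj.comp σ.injective)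
  -- the minimal gap
  set pairs : Finset (Fin n × Fin n) := Finset.univ.filter fun p => p.1 < p.2 with hpairs
  have hne : pairs.Nonempty :=
    ⟨(⟨0, by omega⟩, ⟨1, by omega⟩), Finset.mem_filter.2 ⟨Finset.mem_univ _, Fin.mk_lt_mk.2 (by norm_num)⟩⟩
  set hmin : ℝ := pairs.inf' hne fun p => f (σ p.2) - f (σ p.1) with hhmin
  have hmin_pos : 0 < hmin := by
    rw [hhmin, Finset.lt_inf'_iff]
    intro p hp
    have hp' : p.1 < p.2 := (Finset.mem_filter.1 hp).2
    have := hmono hp'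
    simp only [Function.comp_apply] at this
    linarith
  have hmin_le : ∀ i j : Fin n, i < j → hmin ≤ f (σ j) - f (σ i) := by
    intro i j hij
    have hmem : (i, j) ∈ pairs := Finset.mem_filter.2 ⟨Finset.mem_univ (i, j), hij⟩
    have := Finset.inf'_le (fun p : Fin n × Fin n => f (σ p.2) - f (σ p.1)) hmem
    rw [hhmin]
    exact this
  -- the Lipschitz constant
  set L : ℝ := ∑ i, ‖x i‖ with hL
  have hL0 : 0 ≤ L := Finset.sum_nonneg fun i _ => norm_nonneg _
  have hLi : ∀ i, ‖x i‖ ≤ L := fun i =>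
    Finset.single_le_sum (f := fun i => ‖x i‖) (fun _ _ => norm_nonneg _) (Finset.mem_univ i)
  refine ⟨σ, min 1 (hmin / (8 * (L + 1))), hmin / 2, lt_min one_pos (by positivity), min_le_left _ _,
    by positivity, fun i j hij θ hθ => ?_⟩
  have hθ1 : |θ - θ₁| < hmin / (8 * (L + 1)) := hθ.trans_le (min_le_right _ _)
  have hdi := abs_height_sub_le (x (σ i)) θ θ₁
  have hdj := abs_height_sub_le (x (σ j)) θ θ₁
  have hgap := hmin_le i j hij
  simp only [hf] at hgap
  have hbound : ∀ m : Fin n, 2 * ‖x (σ m)‖ * |θ - θ₁| ≤ hmin / 4 := by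
    intro m
    calc 2 * ‖x (σ m)‖ * |θ - θ₁| ≤ 2 * L * (hmin / (8 * (L + 1))) := by
          gcongr
          exact hLi _
      _ = (L / (L + 1)) * (hmin / 4) := by field_simp; ring
      _ ≤ 1 * (hmin / 4) := by
          gcongr
          rw [div_le_one (by positivity)]; linarith
      _ = hmin / 4 := one_mul _
  have h1 := hbound i
  have h2 := hbound j
  rw [abs_le] at hdi hdj
  linarith [hdi.1, hdi.2, hdj.1, hdj.2]

/-! ## The stub -/

/-- **S4 · `stub_boostEntireOfType`.** INDUCTIVE STEP at level `n ≥ 3`: assuming `O(3)` invariance at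
all levels `< n`, for every axis-generic `x` the orbit function `θ ↦ S n (rot θ ∘ x)` is the
restriction of an entire function of exponential type `2Δ < 4` (Osterwalder–Schrader boost calculus of
the frame `e₀`, `exists_local_boost_continuation`, glued over one period `π/2`). -/
theorem stub_boostEntireOfType :
    ∀ (Δ : ℝ) (S : CorrFamily 3), LimitStructure Δ S → InPlaneLightCone S → TwoSidedSigmaBound Δ S →
      ∀ n : ℕ, 3 ≤ n → (∀ m < n, RotInvAt S m) →
      ∀ x : Fin n → E³, AxisGeneric x →
        ∃ F : ℂ → ℂ, Differentiable ℂ F ∧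
          (∀ θ : ℝ, F (θ : ℂ) = ((S n (fun i => rot θ (x i)) : ℝ) : ℂ)) ∧
          ∃ C τ : ℝ, τ < 4 ∧ ∀ z : ℂ, ‖F z‖ ≤ C * Real.exp (τ * |z.im|) := by
  intro Δ S hL hcone hsig n hn ih x hx
  classical
  obtain ⟨hreg, hRP9⟩ := hL
  have hΔ : 0 ≤ Δ := by linarith [hreg.1.1]
  have hΔ1 : Δ ≤ 1 := hreg.1.2
  have hT : IsTranslationInvariant S := hreg.2.1
  have hO : IsHyperoctahedralInvariant S := hreg.2.2.2.2.2.1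
  have hP : IsPermutationSymmetric S := hreg.2.2.2.2.2.2.1
  obtain ⟨Cpd, hPD⟩ := hreg.2.2.2.2.2.2.2.1
  have hRP : MirrorRP e₀ S := hRP9 e₀ single_zero_mem
  have hLC := frameLightCone_of hcone
  obtain ⟨C, hSB⟩ := frameSigma_of hsig
  have hrot : ∀ m : ℕ, m < n → ∀ (φ : ℝ) (z : Fin m → E³),
      S m (fun i => planeRot (d := 2) 0 φ (z i)) = S m z := fun m hm φ z => ih m hm (rot φ) z
  -- the OS Hilbert space of the frame `e₀` (Mathlib's RKHS of the OS kernel)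
  set kfun : HalfSpaceConfig 3 0 → HalfSpaceConfig 3 0 → ℂ := fun a b => ((osPointKernel S a b : ℝ) : ℂ) with hkfun
  have hk : ∀ a b, conj (kfun b a) = kfun a b := by
    intro a b
    simp only [hkfun, Complex.conj_ofReal, osPointKernel_comm (isReflectionInvariantAlong_zero hO) hP b a]
  haveI : Fact (Matrix.of fun a b => kfun a b • (1 : ℂ →L[ℂ] ℂ)).PosSemidef :=
    ⟨posSemidef_smul_one kfun hk fun c => kernel_psd_complex hRP c⟩
  set δ : HalfSpaceConfig 3 0 → RKHS.OfKernel (Matrix.of fun a b => kfun a b • (1 : ℂ →L[ℂ] ℂ)) :=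
    fun a => RKHS.kerFun (RKHS.OfKernel (Matrix.of fun a b => kfun a b • (1 : ℂ →L[ℂ] ℂ))) a (1 : ℂ) with hδdef
  have hδ : DenseRange (Finsupp.linearCombination ℂ δ) := denseRange_lc_kerFun_one _
  have hK : ∀ a b, ⟪δ a, δ b⟫_ℂ = ((osPointKernel S a b : ℝ) : ℂ) := fun a b => inner_kerFun_one kfun hk a b
  -- local continuations around every angle
  have hloc : ∀ θ₁ : ℝ, ∃ ε : ℝ, 0 < ε ∧ ∃ K : ℝ, ∃ F : ℂ → ℂ,
      DifferentiableOn ℂ F {z : ℂ | |z.re - θ₁| < ε} ∧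
      (∀ θ : ℝ, |θ - θ₁| < ε → F θ = ((S n (fun i => rot θ (x i)) : ℝ) : ℂ)) ∧
      ∀ z : ℂ, |z.re - θ₁| < ε → ‖F z‖ ≤ K * Real.exp (2 * Δ * |z.im|) := by
    -- the frame is usable at `θ₂`: continuation around `θ₂`
    have husable : ∀ θ₂ : ℝ, (∀ i j : Fin n, i ≠ j → rot θ₂ (x i) 0 ≠ rot θ₂ (x j) 0) →
        ∃ ε : ℝ, 0 < ε ∧ ∃ K : ℝ, ∃ F : ℂ → ℂ,
          DifferentiableOn ℂ F {z : ℂ | |z.re - θ₂| < ε} ∧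
          (∀ θ : ℝ, |θ - θ₂| < ε → F θ = ((S n (fun i => rot θ (x i)) : ℝ) : ℂ)) ∧
          ∀ z : ℂ, |z.re - θ₂| < ε → ‖F z‖ ≤ K * Real.exp (2 * Δ * |z.im|) := by
      intro θ₂ hd
      obtain ⟨σ, ε, h, hε, hε1, hh, hgap⟩ := exists_sorted_gaps (by omega) x θ₂ hd
      obtain ⟨F, hFd, hFv, K, hFb⟩ := exists_local_boost_continuation S hΔ δ hδ hK hT hP hLC hSB hPD hn
        (fun i => x (σ i)) hrot hε1 hh hgap
      refine ⟨ε, hε, K, F, hFd, fun θ hθ => ?_, hFb⟩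
      rw [hFv θ hθ]
      norm_cast
      exact hP n σ (fun i => rot θ (x i))
    intro θ₁
    rcases heights_injective_or hx θ₁ with h | h
    · exact husable θ₁ h
    · obtain ⟨ε, hε, K, F, hFd, hFv, hFb⟩ := husable (θ₁ + Real.pi / 2) h
      refine ⟨ε, hε, K, fun z => F (z + (Real.pi / 2 : ℝ)), ?_, fun θ hθ => ?_, fun z hz => ?_⟩
      · refine hFd.comp (differentiableOn_id.add_const _) fun z hz => ?_
        simpa [add_sub_add_right_eq_sub] using hz
      · have e : (θ : ℂ) + ((Real.pi / 2 : ℝ) : ℂ) = ((θ + Real.pi / 2 : ℝ) : ℂ) := by push_cast; ring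
        show F ((θ : ℂ) + ((Real.pi / 2 : ℝ) : ℂ)) = _
        rw [e, hFv _ (by simpa [add_sub_add_right_eq_sub] using hθ)]
        norm_cast
        exact orbit_periodic hO x θ
      · have := hFb (z + ((Real.pi / 2 : ℝ) : ℂ)) (by simpa [add_sub_add_right_eq_sub] using hz)
        simpa using this
  -- gluing over one period
  have hper : ∀ θ : ℝ, ((S n (fun i => rot (θ + Real.pi / 2) (x i)) : ℝ) : ℂ) =
      ((S n (fun i => rot θ (x i)) : ℝ) : ℂ) := fun θ => by exact_mod_cast orbit_periodic hO x θ
  obtain ⟨G, hGd, hGκ, Cst, hGb⟩ := exists_entire_of_periodic_local_continuations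
    (κ := fun θ : ℝ => ((S n (fun i => rot θ (x i)) : ℝ) : ℂ)) (T := Real.pi / 2) (τ := 2 * Δ)
    (by positivity) hper hloc
  exact ⟨G, hGd, hGκ, Cst, 2 * Δ, by linarith, hGb⟩

end Summit.CriticalPhenomena.Ising3DConformalLimit.Cruxes.LimitRotationInvariant.QuarterTurnLiouville

end
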